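import Summits.BirchSwinnertonDyer.BirchSwinnertonDyer.Theorems.EisensteinPrimesKellerYinLemma511NonsplitOfPrint
import Summits.BirchSwinnertonDyer.BirchSwinnertonDyer.Theorems.EisensteinPrimesBSDpOnCellCStubC3ImprimitiveCut
import HarnessLib

/-!
# Crux 4 `BSDpOnCellC` (stmt-BirchSwinnertonDyer-19034), line b1: p613384's two datum hypotheses BY SIGN —
# the NON-SPLIT one from PRINT (CGLS22 Prop. 14) + the frame `μ = 0` + the imprimitive count, the SPLIT one
# from Keller–Yin Lemma 5.1.1 RESTRICTED TO SPLIT `p` + the same (cell `bsd-eis`, seat `bsd-line-x2-p2`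
# gen 4, D-0154 KEY row 5; companions p626493, p622724, p622336, p620653, p613384, p623440)

HONEST FRAMING (cell `bsd-eis`, run/shared/lean/pub/bsd-eis/): composition only (no definition, no new named
fact, no `sorry`); CONDITIONAL theorems — §1 on the PUBLISHED `CastellaGrossiLeeSkinner2022.prop14_…` plus two
inline unprinted inputs, §2 on the split half of the PREPRINT claim `KellerYin2024.lemma511_…_OPEN` (stated
inline with the extra binder) plus the same two inputs; nothing about any curve is asserted; nothing booked;
no label or count moves; BSD and the main conjectures are proved for NO curve. Helper
`--supports stmt-BirchSwinnertonDyer-19034`; closes no registered stub of v12.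

## Why

p623440 (`BSDpOnCellCResidualV11`) reaches crux 4 BY NAME from p613384's per-sign datum hypotheses
`hinvN` / `hinvS` («`μ(X_ac^∅ strict at 𝔭̄) = 0 ∧ ∃ m ≤ λ(X_ac^∅), Q has its first unit coefficient at m`»),
which it derives for BOTH signs from the single named preprint fact `h511` (v12's `stub_lemma511`). After
p626493 (`KellerYinLemma511NonsplitOfPrint.isTorsion_muInvariant_eq_zero_of_prop14_of_not_split`) the
NON-SPLIT sign no longer needs the preprint: this file re-derives

* §1 **`invN_of_prop14_of_muFrame_of_imprimitiveCount`** — `hinvN` from `prop14_residualCharacterSelmer_finite`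
  [PUB] + `hmuFN` (= v12 `stub_muFrame`.1) + `hcountN` (= v12 `stub_imprimitiveCount`.1), through
  `StubC3ImprimitiveCut.le_lambdaInvariant_empty_of_imprimitiveCount` (kernel: `μ(X^{Sf}) = 0 ⇒ μ(X^∅) = 0`,
  `m + Σ curveLocalLambda ≤ λ(X^{Sf}) ⇒ m ≤ λ(X^∅)`);
* §2 **`invS_of_lemma511Split_of_muFrame_of_imprimitiveCount`** — `hinvS` from the statement of
  `lemma511_…_OPEN` with the extra binder `W.HasSplitMultiplicativeReductionAtPrime p` (hypothesis `h511S`,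
  inline; the split-restricted preprint claim) + `hmuFS` + `hcountS`, same kernel.

The sequel `…BSDpOnCellCResidualV13` composes them with p613384 into the crux BY NAME.

References: [CastellaGrossiLeeSkinner2022] §1.2 Prop. 14 (arXiv:2008.02571; Invent. Math. 227 (2022));
[KellerYin2024] Lemma 5.1.1 (L1744–1749), Lemma 5.1.2 (L1750–1769) (arXiv:2402.12781v2);
[GreenbergVatsal2000] §2 Prop. (2.4), Cor. (2.3); [Castella2018] Def. 2.2; cell p626493, p622724, p622336,
p620653, p564629, p613384, p623440.
-/

set_option autoImplicit false
set_option linter.dupNamespace false -- the summit namespace `…BirchSwinnertonDyer.BirchSwinnertonDyer.Theorems` (Sub = Summit, D-0017) trips it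

noncomputable section

open scoped Classical MatrixGroups ModularForm

open CongruenceSubgroup WeierstrassCurve NumberField IsDedekindDomain Field PowerSeries
  Literature.NumberTheory.EllipticCurves Literature.NumberTheory.EllipticCurves.GreenbergSelmer
  Literature.NumberTheory.EllipticCurves.ModularForms
  Literature.NumberTheory.EllipticCurves.Rank1Residual
  Literature.NumberTheory.EllipticCurves.Rank1Residual.Typed
  Literature.NumberTheory.GaloisRepresentations Literature.NumberTheory.GaloisCohomology
  Literature.NumberTheory.Automorphic
  Summit.BirchSwinnertonDyer.Rank1Residual.X11b.AcSelmer
  Summit.BirchSwinnertonDyer.Rank1Residual.X11b.Halves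
  Summit.BirchSwinnertonDyer.Rank1Residual.X11b
  Summit.BirchSwinnertonDyer.Rank1Residual Summit.BirchSwinnertonDyer.Rank1Residual.X2
  Summit.BirchSwinnertonDyer.BirchSwinnertonDyer.Theorems
open Literature.NumberTheory.EllipticCurves.KellerYin2024
  (curveLocalLambda lemma511_imprimitive_isTorsion_muInvariant_eq_zero_mult_OPEN)
open Literature.NumberTheory.EllipticCurves.CastellaGrossiLeeSkinner2022 (prop14_residualCharacterSelmer_finite)

namespace Summit.BirchSwinnertonDyer.BirchSwinnertonDyer.Theorems.StubC3HalvesBySign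

/-! ### §1 The NON-SPLIT datum hypothesis of p613384 from PRINT + `μ(𝓛) = 0` + the imprimitive count -/

/-- **`hinvN` of p613384 at every NON-SPLIT X2c datum — «`μ(X_ac^∅ strict at 𝔭̄) = 0` and `∃ m ≤ λ(X_ac^∅)`
at which `Q` has its first unit coefficient» — from CGLS22 Prop. 14 (`hfact`, PUBLISHED named fact), the
frame input `hmuFN` (SOME first unit coefficient; v12 `stub_muFrame`.1) and the imprimitive count `hcountN`
(v12 `stub_imprimitiveCount`.1).** From the datum: `CellC` ⇒ `2 < p`, `Red`, `Mult`; `N = N_E`; `Sf` by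
`StubC3MultMuLemma.exists_finset_offP`; torsion + `μ = 0` of `X^{Sf}` by
`KellerYinLemma511NonsplitOfPrint.isTorsion_muInvariant_eq_zero_of_prop14_of_not_split` (p626493); then
`StubC3ImprimitiveCut.le_lambdaInvariant_empty_of_imprimitiveCount` (p622724). CONDITIONAL; nothing booked.
[cite: CastellaGrossiLeeSkinner2022, §1.2 Prop. 14 (arXiv:2008.02571; Invent. Math. 227 (2022))]
[cite: KellerYin2024, Lemma 5.1.2 (arXiv:2402.12781v2 L1750–1769) (shape of `hcountN` only)]
[cite: GreenbergVatsal2000, §2 Prop. (2.4) and Cor. (2.3)] [cite: Castella2018, Def. 2.2] -/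
theorem invN_of_prop14_of_muFrame_of_imprimitiveCount
    (hfact : prop14_residualCharacterSelmer_finite)
    (hmuFN :
      ∀ (W : WeierstrassCurve ℚ) [W.IsElliptic] [W.IsGloballyMinimal] (p : ℕ) [Fact p.Prime],
        ∀ (N : ℕ) [NeZero N] (K : Type) [Field K] [NumberField K] (Dt : ModularParametrizationData W N)
          (H : HeegnerDatum N (NumberField.discr K)) (ιK : K →+* ℂ) (P : (W.baseChange K).toAffine.Point),
          CellC W p → ¬ W.HasSplitMultiplicativeReductionAtPrime p → W.conductorNorm ℤ = N →
          IsImaginaryQuadratic K → NumberField.discr K < -4 → SatisfiesHeegnerHypothesis N K →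
          (W.quadraticTwist (NumberField.discr K : ℚ)).entireLFunction 1 ≠ 0 →
          WeierstrassCurve.Affine.Point.map ιK.toRatAlgHom P = heegnerPointComplex Dt H →
          ¬ (p : ℤ) ∣ Dt.c → ¬ IsOfFinAddOrder P →
          Odd (NumberField.discr K) →
          ∀ (κ : ZpExtension K p), κ.IsAnticyclotomic →
            ∀ (γ : Field.absoluteGaloisGroup K) [Fact (κ.IsTopGenerator γ)]
              (𝔭 : HeightOneSpectrum (𝓞 K)), ((p : ℕ) : 𝓞 K) ∈ 𝔭.asIdeal →
              𝔭.asIdeal.ramificationIdx (𝓞 ℚ) = 1 → 𝔭.asIdeal.inertiaDeg (𝓞 ℚ) = 1 →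
              ∀ (𝔭bar : HeightOneSpectrum (𝓞 K)), ((p : ℕ) : 𝓞 K) ∈ 𝔭bar.asIdeal → 𝔭bar ≠ 𝔭 →
                ((Ideal.span {(p : ℤ)}).primesOver (𝓞 K)).ncard = 2 →
              ∀ (f : CuspForm (CongruenceSubgroup.Gamma0 N) 2), IsNewformOf W f →
                ∀ (ι' : PadicAlgCl p ≃+* ℂ),
                  (∀ (w : InfinitePlace K) (k : 𝓞 K),
                    k ∈ 𝔭.asIdeal ↔ ‖ι'.symm (w.embedding (k : K))‖ < 1) →
                  ∀ (ΩK : ℂ) (Ωp : ℂ_[p]) (Q : PowerSeries 𝓞_ℂ_[p]), ΩK ≠ 0 → ‖Ωp‖ = 1 →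
                    R1.IsBDPLFunctionInt p ι' 𝔭 κ γ f ΩK Ωp Q →
                      ∃ m : ℕ, ‖((PowerSeries.coeff m Q : 𝓞_ℂ_[p]) : ℂ_[p])‖ = 1 ∧
                  ∀ i < m, ‖((PowerSeries.coeff i Q : 𝓞_ℂ_[p]) : ℂ_[p])‖ < 1)
    (hcountN :
      ∀ (W : WeierstrassCurve ℚ) [W.IsElliptic] [W.IsGloballyMinimal] (p : ℕ) [Fact p.Prime],
        ∀ (N : ℕ) [NeZero N] (K : Type) [Field K] [NumberField K] (Dt : ModularParametrizationData W N)
          (H : HeegnerDatum N (NumberField.discr K)) (ιK : K →+* ℂ) (P : (W.baseChange K).toAffine.Point),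
          CellC W p → ¬ W.HasSplitMultiplicativeReductionAtPrime p → W.conductorNorm ℤ = N →
          IsImaginaryQuadratic K → NumberField.discr K < -4 → SatisfiesHeegnerHypothesis N K →
          (W.quadraticTwist (NumberField.discr K : ℚ)).entireLFunction 1 ≠ 0 →
          WeierstrassCurve.Affine.Point.map ιK.toRatAlgHom P = heegnerPointComplex Dt H →
          ¬ (p : ℤ) ∣ Dt.c → ¬ IsOfFinAddOrder P →
          Odd (NumberField.discr K) →
          ∀ (κ : ZpExtension K p), κ.IsAnticyclotomic →
            ∀ (γ : Field.absoluteGaloisGroup K) [Fact (κ.IsTopGenerator γ)]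
              (𝔭 : HeightOneSpectrum (𝓞 K)), ((p : ℕ) : 𝓞 K) ∈ 𝔭.asIdeal →
              𝔭.asIdeal.ramificationIdx (𝓞 ℚ) = 1 → 𝔭.asIdeal.inertiaDeg (𝓞 ℚ) = 1 →
              ∀ (𝔭bar : HeightOneSpectrum (𝓞 K)), ((p : ℕ) : 𝓞 K) ∈ 𝔭bar.asIdeal → 𝔭bar ≠ 𝔭 →
                ((Ideal.span {(p : ℤ)}).primesOver (𝓞 K)).ncard = 2 →
              ∀ (f : CuspForm (CongruenceSubgroup.Gamma0 N) 2), IsNewformOf W f →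
                ∀ (ι' : PadicAlgCl p ≃+* ℂ),
                  (∀ (w : InfinitePlace K) (k : 𝓞 K),
                    k ∈ 𝔭.asIdeal ↔ ‖ι'.symm (w.embedding (k : K))‖ < 1) →
                  ∀ (ΩK : ℂ) (Ωp : ℂ_[p]) (Q : PowerSeries 𝓞_ℂ_[p]), ΩK ≠ 0 → ‖Ωp‖ = 1 →
                    R1.IsBDPLFunctionInt p ι' 𝔭 κ γ f ΩK Ωp Q →
                      ∀ (Sf : Finset (HeightOneSpectrum (𝓞 K))),
                        (∀ w : HeightOneSpectrum (𝓞 K), w ∈ Sf ↔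
                          (((W.conductorNorm ℤ : ℤ) : 𝓞 K) ∈ w.asIdeal ∧ ((p : ℕ) : 𝓞 K) ∉ w.asIdeal)) →
                        ∀ m : ℕ, ‖((PowerSeries.coeff m Q : 𝓞_ℂ_[p]) : ℂ_[p])‖ = 1 →
                          (∀ i < m, ‖((PowerSeries.coeff i Q : 𝓞_ℂ_[p]) : ℂ_[p])‖ < 1) →
                            m + ∑ w ∈ Sf, curveLocalLambda κ (W.baseChange K) w ≤
                              lambdaInvariant p (XAc (W.baseChange K) p κ 𝔭bar (↑Sf : Set (HeightOneSpectrum (𝓞 K))) γ))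
    :
    ∀ (W : WeierstrassCurve ℚ) [W.IsElliptic] [W.IsGloballyMinimal] (p : ℕ) [Fact p.Prime],
      ∀ (N : ℕ) [NeZero N] (K : Type) [Field K] [NumberField K] (Dt : ModularParametrizationData W N)
        (H : HeegnerDatum N (NumberField.discr K)) (ιK : K →+* ℂ) (P : (W.baseChange K).toAffine.Point),
        CellC W p → ¬ W.HasSplitMultiplicativeReductionAtPrime p → W.conductorNorm ℤ = N →
        IsImaginaryQuadratic K → NumberField.discr K < -4 → SatisfiesHeegnerHypothesis N K →
        (W.quadraticTwist (NumberField.discr K : ℚ)).entireLFunction 1 ≠ 0 →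
        WeierstrassCurve.Affine.Point.map ιK.toRatAlgHom P = heegnerPointComplex Dt H →
        ¬ (p : ℤ) ∣ Dt.c → ¬ IsOfFinAddOrder P →
        Odd (NumberField.discr K) →
        ∀ (κ : ZpExtension K p), κ.IsAnticyclotomic →
          ∀ (γ : Field.absoluteGaloisGroup K) [Fact (κ.IsTopGenerator γ)]
            (𝔭 : HeightOneSpectrum (𝓞 K)), ((p : ℕ) : 𝓞 K) ∈ 𝔭.asIdeal →
            𝔭.asIdeal.ramificationIdx (𝓞 ℚ) = 1 → 𝔭.asIdeal.inertiaDeg (𝓞 ℚ) = 1 →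
            ∀ (𝔭bar : HeightOneSpectrum (𝓞 K)), ((p : ℕ) : 𝓞 K) ∈ 𝔭bar.asIdeal → 𝔭bar ≠ 𝔭 →
              ((Ideal.span {(p : ℤ)}).primesOver (𝓞 K)).ncard = 2 →
            ∀ (f : CuspForm (CongruenceSubgroup.Gamma0 N) 2), IsNewformOf W f →
              ∀ (ι' : PadicAlgCl p ≃+* ℂ),
                (∀ (w : InfinitePlace K) (k : 𝓞 K),
                  k ∈ 𝔭.asIdeal ↔ ‖ι'.symm (w.embedding (k : K))‖ < 1) →
                ∀ (ΩK : ℂ) (Ωp : ℂ_[p]) (Q : PowerSeries 𝓞_ℂ_[p]), ΩK ≠ 0 → ‖Ωp‖ = 1 →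
                  R1.IsBDPLFunctionInt p ι' 𝔭 κ γ f ΩK Ωp Q →
                    muInvariant p (XAc (W.baseChange K) p κ 𝔭bar ∅ γ) = 0 ∧
                ∃ m ≤ lambdaInvariant p (XAc (W.baseChange K) p κ 𝔭bar ∅ γ),
                  ‖((PowerSeries.coeff m Q : 𝓞_ℂ_[p]) : ℂ_[p])‖ = 1 ∧
                    ∀ i < m, ‖((PowerSeries.coeff i Q : 𝓞_ℂ_[p]) : ℂ_[p])‖ < 1 := by
  intro W _ _ p _ N _ K _ _ Dt H ιK P hc hsg hN hK hd4 hHN hLt hP hcM hPinf hodd κ hκ γ _ 𝔭 h𝔭 he hf 𝔭bar h𝔭bar hne hsplit f hfW ι' hι' ΩK Ωp Q hΩK hΩp hQ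
  have hp2 : 2 < p := by
    have hp := (Fact.out : p.Prime).two_le
    rcases hp.lt_or_eq with h | h
    · exact h
    · exact absurd h.symm hc.2.1
  have hN0 : W.conductorNorm ℤ ≠ 0 := (W.conductorNorm_pos_holds).ne'
  have hHW : SatisfiesHeegnerHypothesis (W.conductorNorm ℤ) K := hN ▸ hHN
  obtain ⟨Sf, hSf⟩ := StubC3MultMuLemma.exists_finset_offP (K := K) hN0 p
  obtain ⟨htor, hμ⟩ :=
    KellerYinLemma511NonsplitOfPrint.isTorsion_muInvariant_eq_zero_of_prop14_of_not_split hfact W K 𝔭bar κ γ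
      Sf hp2 hc.2.2.2 hsg hc.2.2.1 hK hHW hsplit h𝔭bar hκ hSf
  obtain ⟨m, hm, hlt⟩ := hmuFN W p N K Dt H ιK P hc hsg hN hK hd4 hHN hLt hP hcM hPinf hodd κ hκ γ 𝔭 h𝔭 he hf 𝔭bar h𝔭bar hne hsplit f hfW ι' hι' ΩK Ωp Q hΩK hΩp hQ
  have hc' : m + ∑ w ∈ Sf, curveLocalLambda κ (W.baseChange K) w ≤
      lambdaInvariant p
        (Castella2018.AcSelmer.XAc (W.baseChange K) p κ 𝔭bar (↑Sf : Set (HeightOneSpectrum (𝓞 K))) γ) :=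
    hcountN W p N K Dt H ιK P hc hsg hN hK hd4 hHN hLt hP hcM hPinf hodd κ hκ γ 𝔭 h𝔭 he hf 𝔭bar h𝔭bar hne hsplit f hfW ι' hι' ΩK Ωp Q hΩK hΩp hQ Sf hSf m hm hlt
  obtain ⟨-, hμ₀, hle⟩ := StubC3ImprimitiveCut.le_lambdaInvariant_empty_of_imprimitiveCount W hp2 hK hHW κ hκ γ
    𝔭bar Sf hSf htor hμ hc'
  exact ⟨hμ₀, m, hle, hm, hlt⟩

/-! ### §2 The SPLIT datum hypothesis of p613384 from Lemma 5.1.1 RESTRICTED TO SPLIT `p` -/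

/-- **`hinvS` of p613384 at every SPLIT X2c datum from the split-restricted Keller–Yin Lemma 5.1.1 (`h511S`:
the statement of `KellerYin2024.lemma511_imprimitive_isTorsion_muInvariant_eq_zero_mult_OPEN` with the extra binder
`W.HasSplitMultiplicativeReductionAtPrime p`, inline — at a split multiplicative Eisenstein prime the characters of
`E[p]^{ss}|_{G_p}` are `{1, ω}` and no printed statement supplies it), the frame input `hmuFS` and the imprimitive
count `hcountS`.** Same kernel as §1. CONDITIONAL on the preprint claim; nothing booked.
[claim: KellerYin2024, status: under-review]
[cite: KellerYin2024, Lemma 5.1.1 (L1744–1749), Lemma 5.1.2 (L1750–1769) (arXiv:2402.12781v2) (shape only)]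
[cite: GreenbergVatsal2000, §2 Prop. (2.4) and Cor. (2.3)] [cite: Castella2018, Def. 2.2] -/
theorem invS_of_lemma511Split_of_muFrame_of_imprimitiveCount
    (h511S : ∀ {p : ℕ} [Fact p.Prime] (W : WeierstrassCurve ℚ) [W.IsElliptic] [W.IsGloballyMinimal]
        (K : Type) [Field K] [NumberField K] (vbar : HeightOneSpectrum (𝓞 K))
        (κ : ZpExtension K p) (γ : absoluteGaloisGroup K) [Fact (κ.IsTopGenerator γ)]
        (Sf : Finset (HeightOneSpectrum (𝓞 K))),
        2 < p → Mult W p → W.HasSplitMultiplicativeReductionAtPrime p → Red W p →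
        IsImaginaryQuadratic K → SatisfiesHeegnerHypothesis (W.conductorNorm ℤ) K →
          Odd (NumberField.discr K) → NumberField.discr K ≠ -3 →
          ((Ideal.span {(p : ℤ)}).primesOver (𝓞 K)).ncard = 2 →
        ((p : ℕ) : 𝓞 K) ∈ vbar.asIdeal → κ.IsAnticyclotomic →
        (∀ w : HeightOneSpectrum (𝓞 K), w ∈ Sf ↔
          (((W.conductorNorm ℤ : ℤ) : 𝓞 K) ∈ w.asIdeal ∧ ((p : ℕ) : 𝓞 K) ∉ w.asIdeal)) →
        Module.IsTorsion (IwasawaAlgebra p)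
            (Castella2018.AcSelmer.XAc (W.baseChange K) p κ vbar (↑Sf : Set (HeightOneSpectrum (𝓞 K))) γ) ∧
          muInvariant p
            (Castella2018.AcSelmer.XAc (W.baseChange K) p κ vbar (↑Sf : Set (HeightOneSpectrum (𝓞 K))) γ) = 0)
    (hmuFS :
      ∀ (W : WeierstrassCurve ℚ) [W.IsElliptic] [W.IsGloballyMinimal] (p : ℕ) [Fact p.Prime],
        ∀ (N : ℕ) [NeZero N] (K : Type) [Field K] [NumberField K] (Dt : ModularParametrizationData W N)
          (H : HeegnerDatum N (NumberField.discr K)) (ιK : K →+* ℂ) (P : (W.baseChange K).toAffine.Point),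
          CellC W p → W.HasSplitMultiplicativeReductionAtPrime p → W.conductorNorm ℤ = N →
          IsImaginaryQuadratic K → NumberField.discr K < -4 → SatisfiesHeegnerHypothesis N K →
          (W.quadraticTwist (NumberField.discr K : ℚ)).entireLFunction 1 ≠ 0 →
          WeierstrassCurve.Affine.Point.map ιK.toRatAlgHom P = heegnerPointComplex Dt H →
          ¬ (p : ℤ) ∣ Dt.c → ¬ IsOfFinAddOrder P →
          Odd (NumberField.discr K) →
          ∀ (κ : ZpExtension K p), κ.IsAnticyclotomic →
            ∀ (γ : Field.absoluteGaloisGroup K) [Fact (κ.IsTopGenerator γ)]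
              (𝔭 : HeightOneSpectrum (𝓞 K)), ((p : ℕ) : 𝓞 K) ∈ 𝔭.asIdeal →
              𝔭.asIdeal.ramificationIdx (𝓞 ℚ) = 1 → 𝔭.asIdeal.inertiaDeg (𝓞 ℚ) = 1 →
              ∀ (𝔭bar : HeightOneSpectrum (𝓞 K)), ((p : ℕ) : 𝓞 K) ∈ 𝔭bar.asIdeal → 𝔭bar ≠ 𝔭 →
                ((Ideal.span {(p : ℤ)}).primesOver (𝓞 K)).ncard = 2 →
              ∀ (f : CuspForm (CongruenceSubgroup.Gamma0 N) 2), IsNewformOf W f →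
                ∀ (ι' : PadicAlgCl p ≃+* ℂ),
                  (∀ (w : InfinitePlace K) (k : 𝓞 K),
                    k ∈ 𝔭.asIdeal ↔ ‖ι'.symm (w.embedding (k : K))‖ < 1) →
                  ∀ (ΩK : ℂ) (Ωp : ℂ_[p]) (Q : PowerSeries 𝓞_ℂ_[p]), ΩK ≠ 0 → ‖Ωp‖ = 1 →
                    R1.IsBDPLFunctionInt p ι' 𝔭 κ γ f ΩK Ωp Q →
                      ∃ m : ℕ, ‖((PowerSeries.coeff m Q : 𝓞_ℂ_[p]) : ℂ_[p])‖ = 1 ∧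
                  ∀ i < m, ‖((PowerSeries.coeff i Q : 𝓞_ℂ_[p]) : ℂ_[p])‖ < 1)
    (hcountS :
      ∀ (W : WeierstrassCurve ℚ) [W.IsElliptic] [W.IsGloballyMinimal] (p : ℕ) [Fact p.Prime],
        ∀ (N : ℕ) [NeZero N] (K : Type) [Field K] [NumberField K] (Dt : ModularParametrizationData W N)
          (H : HeegnerDatum N (NumberField.discr K)) (ιK : K →+* ℂ) (P : (W.baseChange K).toAffine.Point),
          CellC W p → W.HasSplitMultiplicativeReductionAtPrime p → W.conductorNorm ℤ = N →
          IsImaginaryQuadratic K → NumberField.discr K < -4 → SatisfiesHeegnerHypothesis N K →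
          (W.quadraticTwist (NumberField.discr K : ℚ)).entireLFunction 1 ≠ 0 →
          WeierstrassCurve.Affine.Point.map ιK.toRatAlgHom P = heegnerPointComplex Dt H →
          ¬ (p : ℤ) ∣ Dt.c → ¬ IsOfFinAddOrder P →
          Odd (NumberField.discr K) →
          ∀ (κ : ZpExtension K p), κ.IsAnticyclotomic →
            ∀ (γ : Field.absoluteGaloisGroup K) [Fact (κ.IsTopGenerator γ)]
              (𝔭 : HeightOneSpectrum (𝓞 K)), ((p : ℕ) : 𝓞 K) ∈ 𝔭.asIdeal →
              𝔭.asIdeal.ramificationIdx (𝓞 ℚ) = 1 → 𝔭.asIdeal.inertiaDeg (𝓞 ℚ) = 1 →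
              ∀ (𝔭bar : HeightOneSpectrum (𝓞 K)), ((p : ℕ) : 𝓞 K) ∈ 𝔭bar.asIdeal → 𝔭bar ≠ 𝔭 →
                ((Ideal.span {(p : ℤ)}).primesOver (𝓞 K)).ncard = 2 →
              ∀ (f : CuspForm (CongruenceSubgroup.Gamma0 N) 2), IsNewformOf W f →
                ∀ (ι' : PadicAlgCl p ≃+* ℂ),
                  (∀ (w : InfinitePlace K) (k : 𝓞 K),
                    k ∈ 𝔭.asIdeal ↔ ‖ι'.symm (w.embedding (k : K))‖ < 1) →
                  ∀ (ΩK : ℂ) (Ωp : ℂ_[p]) (Q : PowerSeries 𝓞_ℂ_[p]), ΩK ≠ 0 → ‖Ωp‖ = 1 →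
                    R1.IsBDPLFunctionInt p ι' 𝔭 κ γ f ΩK Ωp Q →
                      ∀ (Sf : Finset (HeightOneSpectrum (𝓞 K))),
                        (∀ w : HeightOneSpectrum (𝓞 K), w ∈ Sf ↔
                          (((W.conductorNorm ℤ : ℤ) : 𝓞 K) ∈ w.asIdeal ∧ ((p : ℕ) : 𝓞 K) ∉ w.asIdeal)) →
                        ∀ m : ℕ, ‖((PowerSeries.coeff m Q : 𝓞_ℂ_[p]) : ℂ_[p])‖ = 1 →
                          (∀ i < m, ‖((PowerSeries.coeff i Q : 𝓞_ℂ_[p]) : ℂ_[p])‖ < 1) →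
                            m + ∑ w ∈ Sf, curveLocalLambda κ (W.baseChange K) w ≤
                              lambdaInvariant p (XAc (W.baseChange K) p κ 𝔭bar (↑Sf : Set (HeightOneSpectrum (𝓞 K))) γ))
    :
    ∀ (W : WeierstrassCurve ℚ) [W.IsElliptic] [W.IsGloballyMinimal] (p : ℕ) [Fact p.Prime],
      ∀ (N : ℕ) [NeZero N] (K : Type) [Field K] [NumberField K] (Dt : ModularParametrizationData W N)
        (H : HeegnerDatum N (NumberField.discr K)) (ιK : K →+* ℂ) (P : (W.baseChange K).toAffine.Point),
        CellC W p → W.HasSplitMultiplicativeReductionAtPrime p → W.conductorNorm ℤ = N →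
        IsImaginaryQuadratic K → NumberField.discr K < -4 → SatisfiesHeegnerHypothesis N K →
        (W.quadraticTwist (NumberField.discr K : ℚ)).entireLFunction 1 ≠ 0 →
        WeierstrassCurve.Affine.Point.map ιK.toRatAlgHom P = heegnerPointComplex Dt H →
        ¬ (p : ℤ) ∣ Dt.c → ¬ IsOfFinAddOrder P →
        Odd (NumberField.discr K) →
        ∀ (κ : ZpExtension K p), κ.IsAnticyclotomic →
          ∀ (γ : Field.absoluteGaloisGroup K) [Fact (κ.IsTopGenerator γ)]
            (𝔭 : HeightOneSpectrum (𝓞 K)), ((p : ℕ) : 𝓞 K) ∈ 𝔭.asIdeal →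
            𝔭.asIdeal.ramificationIdx (𝓞 ℚ) = 1 → 𝔭.asIdeal.inertiaDeg (𝓞 ℚ) = 1 →
            ∀ (𝔭bar : HeightOneSpectrum (𝓞 K)), ((p : ℕ) : 𝓞 K) ∈ 𝔭bar.asIdeal → 𝔭bar ≠ 𝔭 →
              ((Ideal.span {(p : ℤ)}).primesOver (𝓞 K)).ncard = 2 →
            ∀ (f : CuspForm (CongruenceSubgroup.Gamma0 N) 2), IsNewformOf W f →
              ∀ (ι' : PadicAlgCl p ≃+* ℂ),
                (∀ (w : InfinitePlace K) (k : 𝓞 K),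
                  k ∈ 𝔭.asIdeal ↔ ‖ι'.symm (w.embedding (k : K))‖ < 1) →
                ∀ (ΩK : ℂ) (Ωp : ℂ_[p]) (Q : PowerSeries 𝓞_ℂ_[p]), ΩK ≠ 0 → ‖Ωp‖ = 1 →
                  R1.IsBDPLFunctionInt p ι' 𝔭 κ γ f ΩK Ωp Q →
                    muInvariant p (XAc (W.baseChange K) p κ 𝔭bar ∅ γ) = 0 ∧
                ∃ m ≤ lambdaInvariant p (XAc (W.baseChange K) p κ 𝔭bar ∅ γ),
                  ‖((PowerSeries.coeff m Q : 𝓞_ℂ_[p]) : ℂ_[p])‖ = 1 ∧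
                    ∀ i < m, ‖((PowerSeries.coeff i Q : 𝓞_ℂ_[p]) : ℂ_[p])‖ < 1 := by
  intro W _ _ p _ N _ K _ _ Dt H ιK P hc hsg hN hK hd4 hHN hLt hP hcM hPinf hodd κ hκ γ _ 𝔭 h𝔭 he hf 𝔭bar h𝔭bar hne hsplit f hfW ι' hι' ΩK Ωp Q hΩK hΩp hQ
  have hp2 : 2 < p := by
    have hp := (Fact.out : p.Prime).two_le
    rcases hp.lt_or_eq with h | h
    · exact h
    · exact absurd h.symm hc.2.1
  have h3 : NumberField.discr K ≠ -3 := by omega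
  have hN0 : W.conductorNorm ℤ ≠ 0 := (W.conductorNorm_pos_holds).ne'
  have hHW : SatisfiesHeegnerHypothesis (W.conductorNorm ℤ) K := hN ▸ hHN
  obtain ⟨Sf, hSf⟩ := StubC3MultMuLemma.exists_finset_offP (K := K) hN0 p
  obtain ⟨htor, hμ⟩ := h511S W K 𝔭bar κ γ Sf hp2 hc.2.2.2 hsg hc.2.2.1 hK hHW hodd h3 hsplit h𝔭bar hκ hSf
  obtain ⟨m, hm, hlt⟩ := hmuFS W p N K Dt H ιK P hc hsg hN hK hd4 hHN hLt hP hcM hPinf hodd κ hκ γ 𝔭 h𝔭 he hf 𝔭bar h𝔭bar hne hsplit f hfW ι' hι' ΩK Ωp Q hΩK hΩp hQ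
  have hc' : m + ∑ w ∈ Sf, curveLocalLambda κ (W.baseChange K) w ≤
      lambdaInvariant p
        (Castella2018.AcSelmer.XAc (W.baseChange K) p κ 𝔭bar (↑Sf : Set (HeightOneSpectrum (𝓞 K))) γ) :=
    hcountS W p N K Dt H ιK P hc hsg hN hK hd4 hHN hLt hP hcM hPinf hodd κ hκ γ 𝔭 h𝔭 he hf 𝔭bar h𝔭bar hne hsplit f hfW ι' hι' ΩK Ωp Q hΩK hΩp hQ Sf hSf m hm hlt
  obtain ⟨-, hμ₀, hle⟩ := StubC3ImprimitiveCut.le_lambdaInvariant_empty_of_imprimitiveCount W hp2 hK hHW κ hκ γ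
    𝔭bar Sf hSf htor hμ hc'
  exact ⟨hμ₀, m, hle, hm, hlt⟩

end Summit.BirchSwinnertonDyer.BirchSwinnertonDyer.Theorems.StubC3HalvesBySign

end
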